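import Literature.Probability.Percolation.Z2PivotalMeasureIntegral
import Literature.Probability.Percolation.ZdPivotalFourArm
import Literature.Probability.Percolation.FourArmGarbanMonotone
import Literature.Probability.Percolation.ZdFourArmPositivity
import Summits.CriticalPhenomena.CardyFormulaZ2.Theorems.CardyMeckeFlipFlipErgodicityZ2StubLatticePivotalAntitone

/-!
# Crux `FlipErgodicityZ2` (stmt-CriticalPhenomena-14825), line `registered`, stub
# `stub_latticeSecondMoment`: lattice geometry of the edge four-arm events

Route `Summits/CriticalPhenomena/CardyFormulaZ2/Theses/CardyMeckeFlip`.  Helper file (supports the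
crux item) for the uniform second-moment bound of the Garban–Pete–Schramm pivotal measures of
bond-`ℤ²` (`stub_latticeSecondMoment`): the elementary, model-free facts about the cluster-form
event `edgeFourArm W x i` ("four alternating arms from the edge `s(x, x + eᵢ)` to `∂W`",
`Z2PivotalMeasure.lean`) that the second-moment computation (GPS 2013, §4.3–4.4, "these
well-known second moment calculations") uses tacitly:

* `determinedBy_edgeFourArm`, `measurableSet_edgeFourArm` — locality / measurability;
* `relabel_mem_edgeFourArm` — transport under the lattice symmetries of `ℤ²` (translations,
  transposition of the axes), whence the probability of the event for the translated box
  `x + [-N,N]²` and a vertical or horizontal edge is that of the reference event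
  `edgeFourArm [-N,N]² 0 0` (`real_edgeFourArm_shiftBox_eq`);
* `real_edgeFourArm_shiftBox_mono` — antitonicity in the box (arms restrict to sub-blocks,
  `edgeFourArm_of_subset`);
* `relabel_mem_fourArmTwoClusters_of_edgeFourArm` — four arms from the edge to `∂(x + [-M,M]²)`
  contain four arms across every annulus `x + A_{L,M}`, `1 ≤ L ≤ M`, in the cluster form
  `fourArmTwoClusters L M` of `FourArmGarban.lean` (first-exit surgery of the tree,
  `relabel_mem_fourArmTwoClusters_of_arms`, and `mem_fourArmTwoClusters_mono`);
* `unitBlock_eq_box` — GPS's block of Euclidean radius `1` at mesh `δ` is the box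
  `[-⌊1/δ⌋, ⌊1/δ⌋]²`, so that `z2EdgeFourArmProb δ` is the reference probability at
  `N = ⌊1/δ⌋`.
-/

noncomputable section

open MeasureTheory Set Filter Metric
open Literature.Probability.Percolation Literature.Probability.Percolation.QuadCrossing
open Literature.Probability.LatticeModels
open scoped ENNReal Topology

namespace Summit.CriticalPhenomena.CardyFormulaZ2.Theorems.CardyMeckeFlip

/-! ### Locality and measurability -/

/-- The edge four-arm event inside `W` is determined by the pairs of sites of `W`. [folklore] -/
theorem determinedBy_edgeFourArm {W : Set (Site 2)} {K : Set (Sym2 (Site 2))} (hK : W.sym2 ⊆ K)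
    (x : Site 2) (i : Fin 2) : DeterminedBy (edgeFourArm W x i) K :=
  (determinedBy_iff _ _).2 fun _ _ h => mem_edgeFourArm_congr_of_inter_eq hK h x i

/-- The edge four-arm event inside a finite block is measurable. [folklore] -/
theorem measurableSet_edgeFourArm {W : Set (Site 2)} (hW : W.Finite) (x : Site 2) (i : Fin 2) :
    MeasurableSet (edgeFourArm W x i) := by
  refine (determinedBy_edgeFourArm (K := ↑(hW.toFinset.sym2)) ?_ x i).measurableSet_of_finset
  rw [Finset.coe_sym2, Set.Finite.coe_toFinset]

/-- The translated box `x + [-N,N]²` is finite. [folklore] -/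
theorem finite_shiftBox (x : Site 2) (N : ℕ) : {u : Site 2 | u - x ∈ box 2 N}.Finite := by
  have : {u : Site 2 | u - x ∈ box 2 N} = (fun v => v + x) '' ↑(box 2 N) := by
    ext u
    simp only [mem_setOf_eq, mem_image, Finset.mem_coe]
    constructor
    · intro h
      exact ⟨u - x, h, sub_add_cancel u x⟩
    · rintro ⟨v, hv, rfl⟩
      simpa using hv
  rw [this]
  exact (Finset.finite_toSet _).image _

/-! ### Transport under lattice symmetries -/

/-- Graph automorphisms of `ℤ²` carry vertex boundaries to vertex boundaries. [folklore] -/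
theorem mem_vertexBoundary_image_iff (φ : zdGraph 2 ≃g zdGraph 2) (W : Set (Site 2))
    (u : Site 2) : φ.toEquiv u ∈ vertexBoundary (φ.toEquiv '' W) ↔ u ∈ vertexBoundary W := by
  simp only [vertexBoundary, mem_setOf_eq, φ.toEquiv.injective.mem_set_image]
  constructor
  · rintro ⟨hu, w, hw, hadj⟩
    refine ⟨hu, φ.toEquiv.symm w, fun h => hw ?_, ?_⟩
    · have := mem_image_of_mem φ.toEquiv h
      rwa [Equiv.apply_symm_apply] at this
    · rw [← φ.toEquiv.apply_symm_apply w] at hadj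
      exact φ.map_rel_iff'.1 hadj
  · rintro ⟨hu, w, hw, hadj⟩
    exact ⟨hu, φ.toEquiv w, fun h => hw (φ.toEquiv.injective.mem_set_image.1 h),
      φ.map_rel_iff'.2 hadj⟩

/-- Relabelling commutes with deleting an edge. [folklore] -/
theorem relabel_sdiff_singleton (φ : Site 2 ≃ Site 2) (ω : BondConfig (Site 2))
    (e : Sym2 (Site 2)) :
    BondConfig.relabel (sym2Equiv φ) (ω \ {e}) =
      BondConfig.relabel (sym2Equiv φ) ω \ {sym2Equiv φ e} := by
  rw [BondConfig.relabel_apply, BondConfig.relabel_apply, Set.image_sdiff (sym2Equiv φ).injective,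
    Set.image_singleton]

/-- **Lattice symmetries transport the edge four-arm event.**  For a graph automorphism `φ` of
`ℤ²` mapping the edge `s(x, x + eᵢ)` to the edge `s(φ x, φ x + e_j)`, if `ω` has four arms from
`s(x, x + eᵢ)` to `∂W` then `φ '' ω` has four arms from `s(φ x, φ x + e_j)` to `∂(φ W)`.
[folklore] -/
theorem relabel_mem_edgeFourArm (φ : zdGraph 2 ≃g zdGraph 2) {W : Set (Site 2)} {x : Site 2}
    {i j : Fin 2} (hφ : φ.toEquiv (x + Pi.single i 1) = φ.toEquiv x + Pi.single j 1)
    {ω : BondConfig (Site 2)} (h : ω ∈ edgeFourArm W x i) :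
    BondConfig.relabel (sym2Equiv φ.toEquiv) ω ∈ edgeFourArm (φ.toEquiv '' W) (φ.toEquiv x) j := by
  set ψ := φ.toEquiv with hψ
  obtain ⟨⟨u, hu, h1⟩, ⟨u', hu', h2⟩, h3⟩ := h
  have he : sym2Equiv ψ (edgeFrom x i) = edgeFrom (ψ x) j := by
    rw [edgeFrom, edgeFrom, sym2Equiv_mk, hφ]
  have hrel : BondConfig.relabel (sym2Equiv ψ) (ω \ {edgeFrom x i}) =
      BondConfig.relabel (sym2Equiv ψ) ω \ {edgeFrom (ψ x) j} := by
    rw [relabel_sdiff_singleton, he]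
  refine ⟨⟨ψ u, (mem_vertexBoundary_image_iff φ W u).2 hu, ?_⟩,
    ⟨ψ u', (mem_vertexBoundary_image_iff φ W u').2 hu', ?_⟩, fun hc => h3 ?_⟩
  · have := relabel_mem_openConnIn ψ h1
    rwa [hrel] at this
  · have := relabel_mem_openConnIn ψ h2
    rwa [hrel, hφ] at this
  · rw [← hφ, ← hrel] at hc
    have := relabel_mem_openConnIn ψ.symm hc
    rwa [relabel_symm_relabel, Equiv.symm_image_image, Equiv.symm_apply_apply,
      Equiv.symm_apply_apply] at this

/-! ### The reference events `edgeFourArm (x + [-N,N]²) x i` and their probabilities -/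

/-- The translation isomorphism acts by `y ↦ y + v`. [folklore] -/
theorem zdShiftIso_toEquiv_apply (v y : Site 2) : (zdShiftIso v).toEquiv y = y + v := rfl

/-- **Translation invariance of the edge four-arm probability**: the event for the edge
`s(x, x + eᵢ)` inside `x + [-N,N]²` has the probability of the event for `s(0, eᵢ)` inside
`[-N,N]²`. [folklore] -/
theorem real_edgeFourArm_shiftBox (x : Site 2) (N : ℕ) (i : Fin 2) :
    (bondPercolation (zdGraph 2) half).real (edgeFourArm {u : Site 2 | u - x ∈ box 2 N} x i) =
      (bondPercolation (zdGraph 2) half).real (edgeFourArm ↑(box 2 N) 0 i) := by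
  set P := bondPercolation (zdGraph 2) half with hP
  have himg₁ : (zdShiftIso (-x)).toEquiv '' {u : Site 2 | u - x ∈ box 2 N} = ↑(box 2 N) := by
    ext v
    simp only [mem_image, mem_setOf_eq, Finset.mem_coe, zdShiftIso_toEquiv_apply]
    constructor
    · rintro ⟨u, hu, rfl⟩
      simpa [sub_eq_add_neg] using hu
    · intro h
      exact ⟨v + x, by simpa using h, by abel⟩
  have himg₂ : (zdShiftIso x).toEquiv '' ↑(box 2 N) = {u : Site 2 | u - x ∈ box 2 N} := by
    ext u
    simp only [mem_image, mem_setOf_eq, Finset.mem_coe, zdShiftIso_toEquiv_apply]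
    constructor
    · rintro ⟨v, hv, rfl⟩
      simpa using hv
    · intro h
      exact ⟨u - x, h, sub_add_cancel u x⟩
  apply le_antisymm
  · -- translate by `-x`
    have hsub : edgeFourArm {u : Site 2 | u - x ∈ box 2 N} x i ⊆
        BondConfig.relabel (sym2Equiv (Site.shift (-x))) ⁻¹' edgeFourArm ↑(box 2 N) 0 i := by
      intro ω hω
      have key := relabel_mem_edgeFourArm (zdShiftIso (-x)) (W := {u : Site 2 | u - x ∈ box 2 N})
        (x := x) (i := i) (j := i)
        (by rw [zdShiftIso_toEquiv_apply, zdShiftIso_toEquiv_apply, add_right_comm]) hω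
      rw [himg₁, zdShiftIso_toEquiv_apply, add_neg_cancel] at key
      exact key
    calc P.real (edgeFourArm {u : Site 2 | u - x ∈ box 2 N} x i)
        ≤ P.real (BondConfig.relabel (sym2Equiv (Site.shift (-x))) ⁻¹'
            edgeFourArm ↑(box 2 N) 0 i) := measureReal_mono hsub
      _ = P.real (edgeFourArm ↑(box 2 N) 0 i) := bondPercolation_real_preimage_shift _ _ _
  · -- translate by `x`
    have hsub : edgeFourArm (↑(box 2 N) : Set (Site 2)) 0 i ⊆
        BondConfig.relabel (sym2Equiv (Site.shift x)) ⁻¹'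
          edgeFourArm {u : Site 2 | u - x ∈ box 2 N} x i := by
      intro ω hω
      have key := relabel_mem_edgeFourArm (zdShiftIso x) (W := ↑(box 2 N)) (x := 0) (i := i)
        (j := i) (by rw [zdShiftIso_toEquiv_apply, zdShiftIso_toEquiv_apply, add_right_comm]) hω
      rw [himg₂, zdShiftIso_toEquiv_apply, zero_add] at key
      exact key
    calc P.real (edgeFourArm ↑(box 2 N) 0 i)
        ≤ P.real (BondConfig.relabel (sym2Equiv (Site.shift x)) ⁻¹'
            edgeFourArm {u : Site 2 | u - x ∈ box 2 N} x i) := measureReal_mono hsub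
      _ = P.real (edgeFourArm {u : Site 2 | u - x ∈ box 2 N} x i) :=
          bondPercolation_real_preimage_shift _ _ _

/-- The transposition of the axes acts by `(a, b) ↦ (b, a)`. [folklore] -/
theorem transposeIso_toEquiv_apply (y : Site 2) : transposeIso.toEquiv y = ![y 1, y 0] :=
  transposeIso_apply y

/-- The transposition of the axes preserves the boxes. [folklore] -/
theorem image_transposeIso_box (N : ℕ) :
    transposeIso.toEquiv '' (↑(box 2 N) : Set (Site 2)) = ↑(box 2 N) := by
  have hcoe : (⇑transposeIso.toEquiv : Site 2 → Site 2) = ⇑transposeIso := rfl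
  rw [hcoe, image_transposeIso]
  ext u
  simp only [mem_preimage, Finset.mem_coe, mem_box, transposeIso_apply]
  constructor
  · intro h k
    fin_cases k
    · simpa using h 1
    · simpa using h 0
  · intro h k
    fin_cases k
    · simpa using h 1
    · simpa using h 0

/-- **The vertical and the horizontal reference edge have the same four-arm probability**
(transposition of the axes). [folklore] -/
theorem real_edgeFourArm_box_one (N : ℕ) :
    (bondPercolation (zdGraph 2) half).real (edgeFourArm ↑(box 2 N) 0 1) =
      (bondPercolation (zdGraph 2) half).real (edgeFourArm ↑(box 2 N) 0 0) := by
  have h0 : transposeIso.toEquiv (0 : Site 2) = 0 := by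
    rw [transposeIso_toEquiv_apply]; ext k; fin_cases k <;> simp
  have h01 : transposeIso.toEquiv ((0 : Site 2) + Pi.single 1 1) =
      transposeIso.toEquiv 0 + Pi.single 0 1 := by
    rw [transposeIso_toEquiv_apply, transposeIso_toEquiv_apply]; ext k; fin_cases k <;> simp
  have h10 : transposeIso.toEquiv ((0 : Site 2) + Pi.single 0 1) =
      transposeIso.toEquiv 0 + Pi.single 1 1 := by
    rw [transposeIso_toEquiv_apply, transposeIso_toEquiv_apply]; ext k; fin_cases k <;> simp
  apply le_antisymm
  · have hsub : edgeFourArm (↑(box 2 N) : Set (Site 2)) 0 1 ⊆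
        BondConfig.relabel (sym2Equiv transposeIso.toEquiv) ⁻¹' edgeFourArm ↑(box 2 N) 0 0 := by
      intro ω hω
      have key := relabel_mem_edgeFourArm transposeIso (W := ↑(box 2 N)) h01 hω
      rw [image_transposeIso_box, h0] at key
      exact key
    exact (measureReal_mono hsub).trans_eq (bondPercolation_real_preimage_relabel_iso _ _ _)
  · have hsub : edgeFourArm (↑(box 2 N) : Set (Site 2)) 0 0 ⊆
        BondConfig.relabel (sym2Equiv transposeIso.toEquiv) ⁻¹' edgeFourArm ↑(box 2 N) 0 1 := by
      intro ω hω
      have key := relabel_mem_edgeFourArm transposeIso (W := ↑(box 2 N)) h10 hω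
      rw [image_transposeIso_box, h0] at key
      exact key
    exact (measureReal_mono hsub).trans_eq (bondPercolation_real_preimage_relabel_iso _ _ _)

/-- Both reference directions, in one statement: the edge `s(x, x + eᵢ)` inside `x + [-N,N]²`
has the four-arm probability of `s(0, e₀)` inside `[-N,N]²`. [folklore] -/
theorem real_edgeFourArm_shiftBox_eq :
    ∀ (x : Site 2) (N : ℕ) (i : Fin 2),
      (bondPercolation (zdGraph 2) half).real (edgeFourArm {u : Site 2 | u - x ∈ box 2 N} x i) =
        (bondPercolation (zdGraph 2) half).real (edgeFourArm (↑(box 2 N) : Set (Site 2)) 0 0) := by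
  intro x N i
  rw [real_edgeFourArm_shiftBox]
  fin_cases i
  · rfl
  · exact real_edgeFourArm_box_one N

/-! ### Antitonicity in the box -/

/-- `eᵢ ∈ [-M,M]²` for `M ≥ 1`. [folklore] -/
theorem single_mem_box {M : ℕ} (hM : 1 ≤ M) (i : Fin 2) : (Pi.single i 1 : Site 2) ∈ box 2 M := by
  rw [mem_box]
  intro k
  rw [Pi.single_apply]
  split_ifs <;> omega

/-- **Four arms to the boundary of a larger box give four arms to the boundary of a smaller
one** (lattice configurations; `1 ≤ M ≤ N`). [folklore] -/
theorem edgeFourArm_shiftBox_mono {M N : ℕ} (hM : 1 ≤ M) (hMN : M ≤ N) (x : Site 2) (i : Fin 2)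
    {ω : BondConfig (Site 2)} (hω : ω ⊆ (zdGraph 2).edgeSet)
    (h : ω ∈ edgeFourArm {u : Site 2 | u - x ∈ box 2 N} x i) :
    ω ∈ edgeFourArm {u : Site 2 | u - x ∈ box 2 M} x i := by
  refine edgeFourArm_of_subset (W := {u : Site 2 | u - x ∈ box 2 N})
    (W' := {u : Site 2 | u - x ∈ box 2 M}) (fun u (hu : u - x ∈ box 2 M) => box_mono 2 hMN hu)
    ?_ ?_ hω h
  · show x - x ∈ box 2 M
    simp
  · show x + Pi.single i 1 - x ∈ box 2 M
    rw [add_sub_cancel_left]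
    exact single_mem_box hM i

/-- **The edge four-arm probability is antitone in the box**: for `1 ≤ M ≤ N`,
`P(edgeFourArm (x + [-N,N]²)) ≤ P(edgeFourArm (x + [-M,M]²))`. [folklore] -/
theorem real_edgeFourArm_shiftBox_mono {M N : ℕ} (hM : 1 ≤ M) (hMN : M ≤ N) (x : Site 2)
    (i : Fin 2) :
    (bondPercolation (zdGraph 2) half).real (edgeFourArm {u : Site 2 | u - x ∈ box 2 N} x i) ≤
      (bondPercolation (zdGraph 2) half).real (edgeFourArm {u : Site 2 | u - x ∈ box 2 M} x i) := by
  refine ENNReal.toReal_mono (measure_ne_top _ _) (measure_mono_ae ?_)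
  filter_upwards [ae_subset_edgeSet (zdGraph 2) half] with ω hω h
  exact edgeFourArm_shiftBox_mono hM hMN x i hω h

/-- The same for the reference events at the origin. [folklore] -/
theorem real_edgeFourArm_box_mono {M N : ℕ} (hM : 1 ≤ M) (hMN : M ≤ N) :
    (bondPercolation (zdGraph 2) half).real (edgeFourArm ↑(box 2 N) 0 0) ≤
      (bondPercolation (zdGraph 2) half).real (edgeFourArm ↑(box 2 M) 0 0) := by
  rw [← real_edgeFourArm_shiftBox_eq 0 N 0, ← real_edgeFourArm_shiftBox_eq 0 M 0]
  exact real_edgeFourArm_shiftBox_mono hM hMN 0 0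

/-! ### Four arms from the edge contain four arms across the surrounding annuli -/

/-- A boundary site of a block containing `x + [-M,M]²` is not in `x + [-(M-1),M-1]²`
(`M ≥ 1`). [folklore] -/
theorem sub_notMem_box_of_mem_vertexBoundary {W : Set (Site 2)} {x : Site 2} {M : ℕ} (hM : 1 ≤ M)
    (hW : ∀ u : Site 2, u - x ∈ box 2 M → u ∈ W) {u : Site 2} (hu : u ∈ vertexBoundary W) :
    u - x ∉ box 2 (M - 1) := by
  intro hbox
  obtain ⟨-, w, hw, hadj⟩ := hu
  have := ZdPivotal.sub_mem_box_succ_of_adj hbox hadj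
  rw [Nat.sub_add_cancel hM] at this
  exact hw (hW w this)

/-- Relabelling along a graph automorphism preserves lattice configurations. [folklore] -/
theorem relabel_subset_edgeSet (φ : zdGraph 2 ≃g zdGraph 2) {ω : BondConfig (Site 2)}
    (hω : ω ⊆ (zdGraph 2).edgeSet) :
    (BondConfig.relabel (sym2Equiv φ.toEquiv) ω : BondConfig (Site 2)) ⊆ (zdGraph 2).edgeSet := by
  rintro z ⟨z', hz', rfl⟩
  exact (sym2Equiv_mem_edgeSet_iff φ z').2 (hω hz')

/-- **Four arms from the edge `s(x, x + eᵢ)` to `∂W`, with `x + [-M,M]² ⊆ W`, contain four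
alternating arms across the annulus `x + A_{L,M}` for every `1 ≤ L ≤ M`**: the configuration
translated by `-x` lies in `fourArmTwoClusters L M` (GPS's "four arms from a single site to
radius `R`" contain four arms in every annulus around it; first-exit surgery
`relabel_mem_fourArmTwoClusters_of_arms` to `A_{1,M}`, then monotonicity in the inner radius).
[folklore] -/
theorem relabel_mem_fourArmTwoClusters_of_edgeFourArm {W : Set (Site 2)} {x : Site 2} {i : Fin 2}
    {L M : ℕ} (hL : 1 ≤ L) (hLM : L ≤ M) (hW : ∀ u : Site 2, u - x ∈ box 2 M → u ∈ W)
    {ω : BondConfig (Site 2)} (hω : ω ⊆ (zdGraph 2).edgeSet) (h : ω ∈ edgeFourArm W x i) :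
    BondConfig.relabel (sym2Equiv (Site.shift (-x))) ω ∈ fourArmTwoClusters L M := by
  have hM : 1 ≤ M := hL.trans hLM
  obtain ⟨⟨u, hu, h1⟩, ⟨u', hu', h2⟩, h3⟩ := h
  have h3' : ω \ {edgeFrom x i} ∉ openConnIn W x u' := fun hc => by
    rw [openConnIn_comm] at h2
    exact h3 (PlanarDuality.openConnIn_trans hc h2)
  have key := relabel_mem_fourArmTwoClusters_of_arms hω
    ((zdGraph_adj_iff x _).2 ⟨i, Or.inl rfl⟩) hM hW
    (sub_notMem_box_of_mem_vertexBoundary hM hW hu) h1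
    (sub_notMem_box_of_mem_vertexBoundary hM hW hu') h2 h3'
  have hω' : (BondConfig.relabel (sym2Equiv (Site.shift (-x))) ω : BondConfig (Site 2)) ⊆
      (zdGraph 2).edgeSet := relabel_subset_edgeSet (zdShiftIso (-x)) hω
  exact mem_fourArmTwoClusters_mono hL hLM le_rfl hω' key

/-! ### GPS's block of Euclidean radius `1` is a lattice box -/

/-- **`unitBlock δ = [-⌊1/δ⌋, ⌊1/δ⌋]²`** for `δ > 0`. [folklore] -/
theorem unitBlock_eq_box {δ : ℝ} (hδ : 0 < δ) :
    unitBlock δ = (↑(box 2 ⌊δ⁻¹⌋₊) : Set (Site 2)) := by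
  ext v
  simp only [unitBlock, mem_setOf_eq, Finset.mem_coe, mem_box]
  refine forall_congr' fun j => ?_
  rw [abs_mul, abs_of_pos hδ, ← abs_le, mul_comm, ← le_div_iff₀ hδ, one_div,
    ← Int.cast_abs, Int.natCast_floor_eq_floor (inv_nonneg.2 hδ.le), Int.le_floor]

/-- Hence GPS's normalising four-arm probability `α₄(δ, 1)` is the reference probability at
`N = ⌊1/δ⌋`: `z2EdgeFourArmProb δ = P(edgeFourArm [-⌊1/δ⌋, ⌊1/δ⌋]² 0 0)`. [folklore] -/
theorem z2EdgeFourArmProb_eq {δ : ℝ} (hδ : 0 < δ) :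
    z2EdgeFourArmProb δ =
      (bondPercolation (zdGraph 2) half).real (edgeFourArm (↑(box 2 ⌊δ⁻¹⌋₊) : Set (Site 2)) 0 0) := by
  rw [z2EdgeFourArmProb, unitBlock_eq_box hδ]

end Summit.CriticalPhenomena.CardyFormulaZ2.Theorems.CardyMeckeFlip

end
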